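import Summits.Ventures.PercRepro.C025ProfilePLDBridgeTruncate
import Summits.Ventures.PercRepro.C025ProfileGirthPaving

/-!
# PER-LAYER DOMINANCE ON EVERY FINITE PAVING MATROID (night-3 g28)

`proofs/NIGHT3-G28-PAVING.md`.  PER-LAYER DOMINANCE (PLD) of a finite matroid `M` — the family
`Σ_{I ⊆ E} [lo ≤ ρ(I) ≤ hi ∧ Θ ≤ ρ(E∖I) + ρ(I)]·C(ρ(E∖I), δ) ≤ Σ_{I ⊆ E} [lo+δ ≤ ρ(E∖I) ≤ hi+δ]·C(ρ(E∖I), δ)`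
(`Θ ≤ lo+hi+δ`, `lo = 0 ∨ lo+hi+δ ≤ Θ`) — is the exact hypothesis of the landed bridge
`PLDBridge.rls_disjointSum_freeOn_of_pld` (C-025 at every `(p, q)` on every truncation of `M ⊕ freeOn E₃`).
Here it is proved for every PAVING matroid (every circuit has at least `ρ(E)` points), by the natural injection
in source coordinates (NIGHT3-G27-PLD.md §2): a residual source `(I, D)` — `ρ(I) ≤ hi`, `ρ(E∖I) ≥ hi+δ+1`, `D` a
`δ`-subset of a chosen basis of `E ∖ I` — has `ρ(I) + δ ≤ ρ(E) − 1`, so in a paving matroid `I` is independent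
with `|I| = ρ(I)` and `I ∪ D` (fewer than `ρ(E)` points) is independent: the natural image `(E ∖ (I ∪ D), D)`
has corank `ρ(I) + δ ∈ [lo+δ, hi+δ]`, rank `≥ ρ(E∖I) − δ ≥ hi+1`, and `D` lies in the only basis `I ∪ D` of its
corank set.  There are no bad sources at all.
* `exists_indep_subset_card_eq` — a basis selector on finsets;
* `toNat_eRk_le_toNat_eRk_sdiff_add_card` — removing `D` lowers the rank by at most `|D|`;
* `indep_of_toNat_eRk_add_two_le` — in a paving matroid a set of rank `≤ ρ(E) − 2` is independent;
* `indep_of_card_lt_rank` — in a paving matroid a finset of fewer than `ρ(E)` points is independent;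
* `residual_facts` — the three facts about the natural image of a residual source;
* `card_residual_le_card_high` — the injection `RS → THI` on pairs;
* **`pld_of_paving`** — (PLD) for every finite paving matroid, in the binder of the bridge verbatim;
* **`rls_truncate_disjointSum_freeOn_of_paving`** — C-025 at every `(p, q)` on every truncation of
  «paving plus free points».
No `def`, no `instance`, no notation.  Axioms: standard.
-/

open scoped Matroid

namespace PercRepro

open Finset ThmH

namespace PavingPLD

variable {α : Type} [DecidableEq α]

omit [DecidableEq α] in
/-- In a finite matroid every rank is finite. -/
theorem eRk_ne_top (M : Matroid α) [M.Finite] (X : Set α) : M.eRk X ≠ ⊤ :=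
  ne_top_of_le_ne_top (M.eRank_ne_top_iff.2 inferInstance) (M.eRk_le_eRank X)

omit [DecidableEq α] in
/-- `ρ(X) ≤ ρ(E)` in `ℕ`. -/
theorem toNat_eRk_le (M : Matroid α) [M.Finite] (X : Set α) : (M.eRk X).toNat ≤ M.eRank.toNat :=
  ENat.toNat_le_toNat (M.eRk_le_eRank X) (M.eRank_ne_top_iff.2 inferInstance)

omit [DecidableEq α] in
/-- A basis selector on finsets: every finset `X` contains an independent finset of `ρ(X)` points. -/
theorem exists_indep_subset_card_eq (M : Matroid α) (X : Finset α) :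
    ∃ B : Finset α, B ⊆ X ∧ M.Indep (B : Set α) ∧ B.card = (M.eRk (X : Set α)).toNat := by
  obtain ⟨B, hB⟩ := M.exists_isBasis ((X : Set α) ∩ M.E) Set.inter_subset_right
  have hfin : B.Finite := X.finite_toSet.subset (hB.subset.trans Set.inter_subset_left)
  refine ⟨hfin.toFinset, ?_, ?_, ?_⟩
  · rw [← coe_subset, hfin.coe_toFinset]
    exact hB.subset.trans Set.inter_subset_left
  · rw [hfin.coe_toFinset]
    exact hB.indep
  · have h1 := hB.encard_eq_eRk
    rw [M.eRk_inter_ground, hfin.encard_eq_coe_toFinset_card] at h1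
    rw [← h1, ENat.toNat_coe]

/-- Removing `D` lowers the rank by at most `|D|`: `ρ(X) ≤ ρ(X ∖ D) + |D|`. -/
theorem eRk_le_eRk_sdiff_add_card (M : Matroid α) (X D : Finset α) :
    M.eRk (X : Set α) ≤ M.eRk ((X \ D : Finset α) : Set α) + D.card := by
  calc M.eRk (X : Set α) ≤ M.eRk (((X \ D : Finset α) : Set α) ∪ (D : Set α)) := by
        apply M.eRk_mono
        intro a ha
        by_cases h : a ∈ D
        · exact Or.inr h
        · exact Or.inl (by rw [coe_sdiff]; exact ⟨ha, h⟩)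
    _ ≤ M.eRk ((X \ D : Finset α) : Set α) + M.eRk (D : Set α) := M.eRk_union_le_eRk_add_eRk _ _
    _ ≤ M.eRk ((X \ D : Finset α) : Set α) + D.card := by
        apply add_le_add (le_refl _)
        rw [← Set.encard_coe_eq_coe_finsetCard]
        exact M.eRk_le_encard _

/-- The same in `ℕ`. -/
theorem toNat_eRk_le_toNat_eRk_sdiff_add_card (M : Matroid α) [M.Finite] (X D : Finset α) :
    (M.eRk (X : Set α)).toNat ≤ (M.eRk ((X \ D : Finset α) : Set α)).toNat + D.card := by
  have h := eRk_le_eRk_sdiff_add_card M X D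
  obtain ⟨a, ha⟩ : ∃ a : ℕ, M.eRk ((X \ D : Finset α) : Set α) = a :=
    ⟨_, (ENat.coe_toNat (eRk_ne_top M _)).symm⟩
  obtain ⟨b, hb⟩ : ∃ b : ℕ, M.eRk (X : Set α) = b := ⟨_, (ENat.coe_toNat (eRk_ne_top M _)).symm⟩
  rw [ha, hb] at h
  rw [ha, hb, ENat.toNat_coe, ENat.toNat_coe]
  exact_mod_cast h

omit [DecidableEq α] in
/-- In a paving matroid (every circuit has at least `ρ(E)` points) a set of rank `≤ ρ(E) − 2` is independent:
a circuit inside it would have `≥ ρ(E)` points, hence rank `≥ ρ(E) − 1`. -/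
theorem indep_of_toNat_eRk_add_two_le (M : Matroid α) [M.Finite]
    (hpav : ∀ C, M.IsCircuit C → M.eRank ≤ C.encard) (X : Set α) (hX : X ⊆ M.E)
    (h : (M.eRk X).toNat + 2 ≤ M.eRank.toNat) : M.Indep X := by
  by_contra hind
  obtain ⟨C, hCX, hC⟩ := ((M.not_indep_iff hX).1 hind).exists_isCircuit_subset
  have h1 : M.eRank ≤ M.eRk C + 1 := by rw [hC.eRk_add_one_eq]; exact hpav C hC
  have h2 : M.eRk C ≤ M.eRk X := M.eRk_mono hCX
  obtain ⟨x, hx⟩ : ∃ x : ℕ, M.eRk X = x := ⟨_, (ENat.coe_toNat (eRk_ne_top M _)).symm⟩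
  obtain ⟨r, hr⟩ : ∃ r : ℕ, M.eRank = r :=
    ⟨_, (ENat.coe_toNat (M.eRank_ne_top_iff.2 inferInstance)).symm⟩
  rw [hx, ENat.toNat_coe, hr, ENat.toNat_coe] at h
  rw [hr] at h1
  rw [hx] at h2
  have h3 : (r : ℕ∞) ≤ (x : ℕ∞) + 1 := h1.trans (add_le_add h2 (le_refl 1))
  have h4 : r ≤ x + 1 := by exact_mod_cast h3
  omega

omit [DecidableEq α] in
/-- In a paving matroid a finset of fewer than `ρ(E)` points is independent (`PavingRows.girth_of_paving`). -/
theorem indep_of_card_lt_rank (M : Matroid α) [M.Finite]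
    (hpav : ∀ C, M.IsCircuit C → M.eRank ≤ C.encard) (T : Finset α) (hT : T ⊆ gr M)
    (h : T.card < M.eRank.toNat) : M.Indep (T : Set α) := by
  obtain ⟨r, hr⟩ : ∃ r : ℕ, M.eRank = r :=
    ⟨_, (ENat.coe_toNat (M.eRank_ne_top_iff.2 inferInstance)).symm⟩
  rw [hr, ENat.toNat_coe] at h
  have hq : ((T.card : ℕ) : ℕ∞) < M.eRank := by rw [hr]; exact_mod_cast h
  apply PavingRows.girth_of_paving hpav hq
  · rw [← coe_gr]; exact coe_subset.2 hT
  · rw [Set.encard_coe_eq_coe_finsetCard]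

/-- **The natural image of a residual source.**  For a residual source `(I, D)` of a paving matroid — `I ⊆ E`,
`ρ(I) ≤ hi`, `ρ(E ∖ I) ≥ hi + δ + 1`, `D` a `δ`-subset of the selected basis `K(E ∖ I)` — the set `I ∪ D` has
rank `ρ(I) + δ`, `D` lies in the selected basis `K(I ∪ D)`, and `E ∖ (I ∪ D)` has rank `≥ hi + 1`. -/
theorem residual_facts (M : Matroid α) [M.Finite] (hpav : ∀ C, M.IsCircuit C → M.eRank ≤ C.encard)
    (K : Finset α → Finset α)
    (hK : ∀ X, K X ⊆ X ∧ M.Indep (K X : Set α) ∧ (K X).card = (M.eRk (X : Set α)).toNat)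
    {hi δ : ℕ} {I D : Finset α} (hI : I ⊆ gr M) (hx : (M.eRk (I : Set α)).toNat ≤ hi)
    (hf : hi + δ + 1 ≤ (M.eRk ((gr M \ I : Finset α) : Set α)).toNat)
    (hD : D ∈ powersetCard δ (K (gr M \ I))) :
    (M.eRk ((I ∪ D : Finset α) : Set α)).toNat = (M.eRk (I : Set α)).toNat + δ ∧
    D ⊆ K (I ∪ D) ∧
    hi + 1 ≤ (M.eRk ((gr M \ (I ∪ D) : Finset α) : Set α)).toNat := by
  rw [mem_powersetCard] at hD
  obtain ⟨hDK, hDcard⟩ := hD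
  have hDE : D ⊆ gr M \ I := hDK.trans (hK _).1
  have hDI : Disjoint I D := disjoint_of_subset_right hDE sdiff_disjoint.symm
  have hr : (M.eRk ((gr M \ I : Finset α) : Set α)).toNat ≤ M.eRank.toNat := toNat_eRk_le M _
  have hC : hi + 1 ≤ (M.eRk ((gr M \ (I ∪ D) : Finset α) : Set α)).toNat := by
    have h1 := toNat_eRk_le_toNat_eRk_sdiff_add_card M (gr M \ I) D
    have h2 : (gr M \ I) \ D = gr M \ (I ∪ D) := by
      ext a
      simp only [mem_sdiff, mem_union]
      tauto
    rw [h2] at h1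
    omega
  rcases Nat.eq_zero_or_pos δ with hδ | hδ
  · subst hδ
    have hD0 : D = ∅ := card_eq_zero.1 hDcard
    subst hD0
    exact ⟨by simp, by simp, hC⟩
  · have hIind : M.Indep (I : Set α) := by
      apply indep_of_toNat_eRk_add_two_le M hpav _ (by rw [← coe_gr]; exact coe_subset.2 hI)
      omega
    have hIcard : I.card = (M.eRk (I : Set α)).toNat := by
      rw [hIind.eRk_eq_encard, Set.encard_coe_eq_coe_finsetCard, ENat.toNat_coe]
    have hUcard : (I ∪ D).card = (M.eRk (I : Set α)).toNat + δ := by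
      rw [card_union_of_disjoint hDI, hIcard, hDcard]
    have hUE : I ∪ D ⊆ gr M := union_subset hI (hDE.trans sdiff_subset)
    have hUind : M.Indep ((I ∪ D : Finset α) : Set α) := by
      apply indep_of_card_lt_rank M hpav _ hUE
      rw [hUcard]
      omega
    have hA : (M.eRk ((I ∪ D : Finset α) : Set α)).toNat = (M.eRk (I : Set α)).toNat + δ := by
      rw [hUind.eRk_eq_encard, Set.encard_coe_eq_coe_finsetCard, ENat.toNat_coe, hUcard]
    refine ⟨hA, ?_, hC⟩
    have hKeq : K (I ∪ D) = I ∪ D := by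
      apply eq_of_subset_of_card_le (hK _).1
      rw [(hK _).2.2, hA, hUcard]
    rw [hKeq]
    exact subset_union_right

/-- **The injection `RS → THI`.**  The residual pairs `(I, D)` (`I ⊆ E`, `lo ≤ ρ(I) ≤ hi`, `ρ(E∖I) ≥ hi+δ+1`,
`D` a `δ`-subset of `K(E∖I)`) inject into the high pairs `(J, D')` (`J ⊆ E`, `lo+δ ≤ ρ(E∖J) ≤ hi+δ`,
`ρ(J) ≥ hi+1`, `D'` a `δ`-subset of `K(E∖J)`) by `(I, D) ↦ (E ∖ (I ∪ D), D)`. -/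
theorem card_residual_le_card_high (M : Matroid α) [M.Finite]
    (hpav : ∀ C, M.IsCircuit C → M.eRank ≤ C.encard) (K : Finset α → Finset α)
    (hK : ∀ X, K X ⊆ X ∧ M.Indep (K X : Set α) ∧ (K X).card = (M.eRk (X : Set α)).toNat)
    (lo hi δ : ℕ) :
    (((gr M).powerset.filter (fun I : Finset α => lo ≤ (M.eRk (I : Set α)).toNat ∧ (M.eRk (I : Set α)).toNat ≤ hi ∧
        hi + δ + 1 ≤ (M.eRk ((gr M \ I : Finset α) : Set α)).toNat)).sigma
      (fun I : Finset α => powersetCard δ (K (gr M \ I)))).card ≤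
    (((gr M).powerset.filter (fun J : Finset α => lo + δ ≤ (M.eRk ((gr M \ J : Finset α) : Set α)).toNat ∧
        (M.eRk ((gr M \ J : Finset α) : Set α)).toNat ≤ hi + δ ∧ hi + 1 ≤ (M.eRk (J : Set α)).toNat)).sigma
      (fun J : Finset α => powersetCard δ (K (gr M \ J)))).card := by
  apply card_le_card_of_injOn (fun p => (⟨gr M \ (p.1 ∪ p.2), p.2⟩ : Σ _ : Finset α, Finset α))
  · intro p hp
    rw [mem_coe, mem_sigma, mem_filter, mem_powerset] at hp
    obtain ⟨⟨hI, hlo, hhi, hf⟩, hD⟩ := hp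
    obtain ⟨hA, hB, hC⟩ := residual_facts M hpav K hK hI hhi hf hD
    have hUE : p.1 ∪ p.2 ⊆ gr M := by
      rw [mem_powersetCard] at hD
      exact union_subset hI ((hD.1.trans (hK _).1).trans sdiff_subset)
    rw [mem_coe, mem_sigma, mem_filter, mem_powerset]
    refine ⟨⟨sdiff_subset, ?_⟩, ?_⟩
    · rw [Finset.sdiff_sdiff_eq_self hUE, hA]
      exact ⟨by omega, by omega, hC⟩
    · rw [Finset.sdiff_sdiff_eq_self hUE, mem_powersetCard]
      rw [mem_powersetCard] at hD
      exact ⟨hB, hD.2⟩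
  · intro p hp q hq hpq
    rw [mem_coe, mem_sigma, mem_filter, mem_powerset] at hp hq
    obtain ⟨⟨hIp, -, -, -⟩, hDp⟩ := hp
    obtain ⟨⟨hIq, -, -, -⟩, hDq⟩ := hq
    rw [mem_powersetCard] at hDp hDq
    have hDpE : p.2 ⊆ gr M \ p.1 := hDp.1.trans (hK _).1
    have hDqE : q.2 ⊆ gr M \ q.1 := hDq.1.trans (hK _).1
    have hUp : p.1 ∪ p.2 ⊆ gr M := union_subset hIp (hDpE.trans sdiff_subset)
    have hUq : q.1 ∪ q.2 ⊆ gr M := union_subset hIq (hDqE.trans sdiff_subset)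
    simp only [Sigma.mk.inj_iff, heq_eq_eq] at hpq
    obtain ⟨h1, h2⟩ := hpq
    have h3 : p.1 ∪ p.2 = q.1 ∪ q.2 := by
      rw [← Finset.sdiff_sdiff_eq_self hUp, ← Finset.sdiff_sdiff_eq_self hUq, h1]
    have h4 : p.1 = q.1 := by
      have hp' : p.1 = (p.1 ∪ p.2) \ p.2 :=
        (union_sdiff_cancel_right (disjoint_of_subset_right hDpE sdiff_disjoint.symm)).symm
      have hq' : q.1 = (q.1 ∪ q.2) \ q.2 :=
        (union_sdiff_cancel_right (disjoint_of_subset_right hDqE sdiff_disjoint.symm)).symm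
      rw [hp', hq', h3, h2]
    exact Sigma.ext h4 (heq_of_eq h2)

/-- **PER-LAYER DOMINANCE ON EVERY FINITE PAVING MATROID**, in the binder of
`PLDBridge.rls_disjointSum_freeOn_of_pld` verbatim. -/
theorem pld_of_paving (M : Matroid α) [M.Finite] (hpav : ∀ C, M.IsCircuit C → M.eRank ≤ C.encard) :
    ∀ lo hi δ Θ : ℕ, Θ ≤ lo + hi + δ → (lo = 0 ∨ lo + hi + δ ≤ Θ) →
      (∑ I ∈ (gr M).powerset, (if lo ≤ (M.eRk (I : Set α)).toNat ∧ (M.eRk (I : Set α)).toNat ≤ hi ∧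
          Θ ≤ (M.eRk ((gr M \ I : Finset α) : Set α)).toNat + (M.eRk (I : Set α)).toNat then
          ((M.eRk ((gr M \ I : Finset α) : Set α)).toNat).choose δ else 0)) ≤
        ∑ I ∈ (gr M).powerset, (if lo + δ ≤ (M.eRk ((gr M \ I : Finset α) : Set α)).toNat ∧
          (M.eRk ((gr M \ I : Finset α) : Set α)).toNat ≤ hi + δ then
          ((M.eRk ((gr M \ I : Finset α) : Set α)).toNat).choose δ else 0) := by
  intro lo hi δ Θ hΘ hside
  choose K hK using exists_indep_subset_card_eq M
  -- split the left side into the low part (corank ≤ hi + δ) and the residual part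
  have hL : (∑ I ∈ (gr M).powerset, (if lo ≤ (M.eRk (I : Set α)).toNat ∧ (M.eRk (I : Set α)).toNat ≤ hi ∧
          Θ ≤ (M.eRk ((gr M \ I : Finset α) : Set α)).toNat + (M.eRk (I : Set α)).toNat then
          ((M.eRk ((gr M \ I : Finset α) : Set α)).toNat).choose δ else 0)) =
      (∑ I ∈ (gr M).powerset, (if lo ≤ (M.eRk (I : Set α)).toNat ∧ (M.eRk (I : Set α)).toNat ≤ hi ∧
          Θ ≤ (M.eRk ((gr M \ I : Finset α) : Set α)).toNat + (M.eRk (I : Set α)).toNat ∧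
          (M.eRk ((gr M \ I : Finset α) : Set α)).toNat ≤ hi + δ then
          ((M.eRk ((gr M \ I : Finset α) : Set α)).toNat).choose δ else 0)) +
      (∑ I ∈ (gr M).powerset, (if lo ≤ (M.eRk (I : Set α)).toNat ∧ (M.eRk (I : Set α)).toNat ≤ hi ∧
          hi + δ + 1 ≤ (M.eRk ((gr M \ I : Finset α) : Set α)).toNat then
          ((M.eRk ((gr M \ I : Finset α) : Set α)).toNat).choose δ else 0)) := by
    rw [← sum_add_distrib]
    apply sum_congr rfl
    intro I _
    split_ifs <;> omega
  -- split the right side into the low part (rank ≤ hi) and the high part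
  have hR : (∑ I ∈ (gr M).powerset, (if lo + δ ≤ (M.eRk ((gr M \ I : Finset α) : Set α)).toNat ∧
          (M.eRk ((gr M \ I : Finset α) : Set α)).toNat ≤ hi + δ then
          ((M.eRk ((gr M \ I : Finset α) : Set α)).toNat).choose δ else 0)) =
      (∑ I ∈ (gr M).powerset, (if lo + δ ≤ (M.eRk ((gr M \ I : Finset α) : Set α)).toNat ∧
          (M.eRk ((gr M \ I : Finset α) : Set α)).toNat ≤ hi + δ ∧ (M.eRk (I : Set α)).toNat ≤ hi then
          ((M.eRk ((gr M \ I : Finset α) : Set α)).toNat).choose δ else 0)) +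
      (∑ I ∈ (gr M).powerset, (if lo + δ ≤ (M.eRk ((gr M \ I : Finset α) : Set α)).toNat ∧
          (M.eRk ((gr M \ I : Finset α) : Set α)).toNat ≤ hi + δ ∧ hi + 1 ≤ (M.eRk (I : Set α)).toNat then
          ((M.eRk ((gr M \ I : Finset α) : Set α)).toNat).choose δ else 0)) := by
    rw [← sum_add_distrib]
    apply sum_congr rfl
    intro I _
    split_ifs <;> omega
  rw [hL, hR]
  apply Nat.add_le_add
  · -- low sources are right-hand pairs (or weigh 0)
    apply sum_le_sum
    intro I _
    split_ifs with h1 h2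
    · exact le_rfl
    · apply Nat.le_of_eq
      apply Nat.choose_eq_zero_of_lt
      omega
    · exact Nat.zero_le _
    · exact le_rfl
  · -- the residual sources inject into the high pairs
    rw [← sum_filter, ← sum_filter]
    have e1 : ∀ s : Finset (Finset α), ∑ I ∈ s, ((M.eRk ((gr M \ I : Finset α) : Set α)).toNat).choose δ =
        (s.sigma (fun I : Finset α => powersetCard δ (K (gr M \ I)))).card := by
      intro s
      rw [card_sigma]
      apply sum_congr rfl
      intro I _
      rw [card_powersetCard, (hK _).2.2]
    rw [e1, e1]
    exact card_residual_le_card_high M hpav K hK lo hi δ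

/-- **C-025 AT EVERY `(p, q)` ON EVERY TRUNCATION OF «PAVING PLUS FREE POINTS»**: for every finite paving
matroid `M`, every finite `E₃` disjoint from `E_M` and every `r`, `ThmN.RLS (truncate (M ⊕ freeOn E₃) r) p q`. -/
theorem rls_truncate_disjointSum_freeOn_of_paving (M : Matroid α) [M.Finite]
    (hpav : ∀ C, M.IsCircuit C → M.eRank ≤ C.encard) (E₃ : Finset α)
    (h : Disjoint M.E (E₃ : Set α)) (r p q : ℕ) :
    haveI := PLDBridge.disjointSum_freeOn_finite M E₃ h
    ThmN.RLS (Matroid.truncate (M.disjointSum (Matroid.freeOn (E₃ : Set α)) h) r) p q :=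
  PLDBridge.rls_disjointSum_freeOn_of_pld M E₃ h r p q (pld_of_paving M hpav)

end PavingPLD

end PercRepro
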